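import Literature.MathematicalPhysics.QuantumFieldTheory.Balaban1983to89.B9SectBStepWhole
import Literature.MathematicalPhysics.QuantumFieldTheory.Balaban1983to89.B9SectBCodedCarrier

/-!
# `Balaban1983to89.B9SectBStepL2FamilyTransferPos` — the positive-input (3.46) block-step `StepL2Pos` TRANSFERS between two readings of the same
# operators whose blocks dominate each other («of course with different constants», p. 403): input domination at the base, output domination at `U′U`

T. Bałaban, *Propagators for lattice gauge theories in a background field*, Commun. Math. Phys. **99** (1985) 389–434
[`Balaban1985BackgroundPropagators`, "B9"], Theorem 3.1 (3.46) p. 398, Theorem 3.4 p. 400, Sect. B pp. 400–407, p. 403 l.1–9.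

statement-level skeleton of published theorems with citation tags; proofs where landed; nothing here is a claim about the
Yang–Mills mass gap

WHY THIS FILE (pub-ymgap N06 row 13, seat dag-n06-c gen 9; interface word of the chain owner dag-n06-d g10: «StepPos currency»).  The certificate knits
row 13 from the positive-input block-steps `B9SectBStepWhole.StepXPos`.  The (3.46) step of the CODED family with augmented `L²` member
(`B9SectBL2StepCodedOn.stepL2Pos_KSC₃_on`) must be transported to the record's own reading: at the base the record's Theorem-3.1–3.3 blocks give the coded
family's (an input domination, `B9SectBCodedChainL2.hin_KSC₃_on_pos`-type, positive constants), at `U′U` the coded family's (3.46) block gives the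
record's (`B9SectBL2SecondOrderY.l2Block_record_at_W_of_KSC₃'`-type).  This file is the generic quantifier bookkeeping of that transport for
`StepL2Pos`, the sibling of `B9SectBStepFamilyTransferPos.sectBStepPrinted_of_family_pos` for one block.
Value = bookkeeping; NOT summit progress; N06 is not discharged by this file.
-/

namespace Literature.MathematicalPhysics.QuantumFieldTheory.Balaban1983to89.B9SectBStepL2FamilyTransferPos

open Literature.MathematicalPhysics.QuantumFieldTheory.Balaban1983to89.B9 (Backgrounds Geometry KernelFamily SiteKernel Thms31to33IneqAt)
open Literature.MathematicalPhysics.QuantumFieldTheory.Balaban1983to89.B9FromB6 (L2Block)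
open Literature.MathematicalPhysics.QuantumFieldTheory.Balaban1983to89.B9SectBStepWhole (StepL2Pos)
open Literature.MathematicalPhysics.QuantumFieldTheory.Balaban1983to89.B9SectBCodedCarrier (Coding pullK pullS)

variable {I : Type} (d : ℕ) (c35 : ℝ) (geo : I → Geometry) (bg : I → Backgrounds)
  (Gp₁ Gp₂ GA₁ GA₂ K₁ K₂ : ∀ i, KernelFamily (geo i) (bg i)) (Cinv : ∀ i, SiteKernel (geo i) (bg i))

/-- ★ **THE POSITIVE-INPUT (3.46) BLOCK-STEP TRANSFERS BETWEEN MUTUALLY DOMINATING READINGS.**  Inputs: `hin` — at every (3.35)-regular base (above a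
threshold, `Mα₀ ≦ ai`) the Theorem-3.1–3.3 blocks of `(Gp₂, GA₂, Cinv)` with POSITIVE constants give those of `(Gp₁, GA₁, Cinv)` with positive constants,
uniformly; `hout` — for every `(B, δ) > 0` and cap `a > 0` there are a cap `0 < a′ ≦ a`, a threshold and `(B′, δ′) > 0` such that at every product `U′U`
(`U` regular above the threshold, `U′` in (3.37) at `0 < α₁ ≦ a′`) the (3.46) block of `K₁` at `(B, δ)` gives that of `K₂` at `(B′, δ′)`.  Then
`StepL2Pos … Gp₁ GA₁ Cinv K₁` gives `StepL2Pos … Gp₂ GA₂ Cinv K₂`. [cite: Balaban1985BackgroundPropagators, Thm 3.1 (3.46) p.398, Thm 3.4 p.400, p.403 l.1–9, (3.35)–(3.37) p.396] -/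
theorem stepL2Pos_of_family_pos
    (hin : ∀ (B₀ δ₀ : ℝ) (Bβ Bε : ℝ → ℝ) (Bεβ : ℝ → ℝ → ℝ) (B₁ δ₁ : ℝ), 0 < B₀ → 0 < δ₀ → 0 < B₁ → 0 < δ₁ →
      ∃ (Mi ai B₀' δ₀' : ℝ) (Bβ' Bε' : ℝ → ℝ) (Bεβ' : ℝ → ℝ → ℝ) (B₁' δ₁' : ℝ), 0 < ai ∧ 0 < B₀' ∧ 0 < δ₀' ∧ 0 < B₁' ∧ 0 < δ₁' ∧
        ∀ i : I, Mi ≤ (geo i).M → ∀ α₀ : ℝ, 0 < α₀ → (geo i).M * α₀ ≤ ai → ∀ U : (bg i).Cfg, (bg i).Reg335 c35 α₀ U →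
          Thms31to33IneqAt d (Gp₂ i) (GA₂ i) (Cinv i) B₀ δ₀ Bβ Bε Bεβ B₁ δ₁ U →
          Thms31to33IneqAt d (Gp₁ i) (GA₁ i) (Cinv i) B₀' δ₀' Bβ' Bε' Bεβ' B₁' δ₁' U)
    (hout : ∀ (B δ a : ℝ), 0 < B → 0 < δ → 0 < a →
      ∃ (Mo ao a' B' δ' : ℝ), 0 < ao ∧ 0 < a' ∧ a' ≤ a ∧ 0 < B' ∧ 0 < δ' ∧
        ∀ i : I, Mo ≤ (geo i).M → ∀ α₀ : ℝ, 0 < α₀ → (geo i).M * α₀ ≤ ao → ∀ U : (bg i).Cfg, (bg i).Reg335 c35 α₀ U →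
          ∀ α₁ : ℝ, 0 < α₁ → α₁ ≤ a' → ∀ U' : (bg i).Cfg, (bg i).Cplx337 α₁ U U' →
          L2Block (K₁ i) B δ ((bg i).mul U' U) → L2Block (K₂ i) B' δ' ((bg i).mul U' U))
    (h : StepL2Pos d c35 geo bg Gp₁ GA₁ Cinv K₁) :
    StepL2Pos d c35 geo bg Gp₂ GA₂ Cinv K₂ := by
  intro B₀ δ₀ Bβ Bε Bεβ B₁ δ₁ hB₀ hδ₀ hB₁ hδ₁
  obtain ⟨Mi, ai, B₀i, δ₀i, Bβi, Bεi, Bεβi, B₁i, δ₁i, hai, hB₀i, hδ₀i, hB₁i, hδ₁i, Hin⟩ := hin B₀ δ₀ Bβ Bε Bεβ B₁ δ₁ hB₀ hδ₀ hB₁ hδ₁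
  obtain ⟨M₀, a₁, a₀', ⟨B, δ⟩, hM₀, ha₁, ha₀', ⟨hB, hδ⟩, H⟩ := h B₀i δ₀i Bβi Bεi Bεβi B₁i δ₁i hB₀i hδ₀i hB₁i hδ₁i
  obtain ⟨Mo, ao, a', B', δ', hao, ha', ha'a, hB', hδ', Hout⟩ := hout B δ a₁ hB hδ ha₁
  refine ⟨max M₀ (max Mi (max Mo 1)), a', min a₀' (min ai ao), ⟨B', δ'⟩, lt_max_of_lt_right (lt_max_of_lt_right (lt_max_of_lt_right one_pos)), ha',
    lt_min ha₀' (lt_min hai hao), ⟨hB', hδ'⟩, fun i hM α₀ hα₀ hMa U hU hT α₁ hα₁ hα₁a U' hU' => ?_⟩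
  have hM0 : M₀ ≤ (geo i).M := le_trans (le_max_left _ _) hM
  have hMi : Mi ≤ (geo i).M := le_trans (le_trans (le_max_left _ _) (le_max_right _ _)) hM
  have hMo : Mo ≤ (geo i).M := le_trans (le_trans (le_trans (le_max_left _ _) (le_max_right _ _)) (le_max_right _ _)) hM
  have ha0 : (geo i).M * α₀ ≤ a₀' := le_trans hMa (min_le_left _ _)
  have hai' : (geo i).M * α₀ ≤ ai := le_trans hMa (le_trans (min_le_right _ _) (min_le_left _ _))
  have hao' : (geo i).M * α₀ ≤ ao := le_trans hMa (le_trans (min_le_right _ _) (min_le_right _ _))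
  have hT₁ := Hin i hMi α₀ hα₀ hai' U hU hT
  have h₁ := H i hM0 α₀ hα₀ ha0 U hU hT₁ α₁ hα₁ (le_trans hα₁a ha'a) U' hU'
  exact Hout i hMo α₀ hα₀ hao' U hU α₁ hα₁ hα₁a U' hU' h₁

/-- ★ **THE POSITIVE-INPUT (3.46) BLOCK-STEP TRANSFERS FROM THE CODING BACK TO THE RECORD** (as `B9SectBCodedCarrier.sectBStepPrinted_of_coded`, for one
block): if `StepL2Pos` holds for the pulled-back families over the coded carriers with output family `pullK 𝔠 K`, and the class implication `hclass` codes every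
`U′` of the record's (3.37) at `α₁ ≦ αcap` by some `a` with `C37 (r·α₁) U a`, then `StepL2Pos` holds for the record's families with output `K`:
thresholds `max M₀ Mc`, caps `min (a₁/r) αcap`, `min a₀′ ac`, constants unchanged (the step at `(U, U′)` is the coded step at `(base U, mult a)`, read at
`dec (prod U a) = U′U`). [cite: Balaban1985BackgroundPropagators, Thm 3.4 p.400, Thm 3.1 (3.46) p.398, (3.35)–(3.37) p.396] -/
theorem stepL2Pos_of_coded (𝔠 : ∀ i, Coding (bg i)) (K : ∀ i, KernelFamily (geo i) (bg i)) {r αcap Mc ac : ℝ} (hr : 0 < r) (hcap : 0 < αcap) (hac : 0 < ac)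
    (hclass : ∀ (i : I) (α₀ α₁ : ℝ) (U U' : (bg i).Cfg), Mc ≤ (geo i).M → 0 < α₀ → (geo i).M * α₀ ≤ ac →
      (bg i).Reg335 c35 α₀ U → 0 < α₁ → α₁ ≤ αcap → (bg i).Cplx337 α₁ U U' →
      ∃ a : (𝔠 i).A, (𝔠 i).decA a = U' ∧ (𝔠 i).C37 (r * α₁) U a)
    (h : StepL2Pos d c35 geo (fun i => (𝔠 i).bg) (fun i => pullK (𝔠 i) (Gp₁ i)) (fun i => pullK (𝔠 i) (GA₁ i)) (fun i => pullS (𝔠 i) (Cinv i))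
      (fun i => pullK (𝔠 i) (K i))) :
    StepL2Pos d c35 geo bg Gp₁ GA₁ Cinv K := by
  intro B₀ δ₀ Bβ Bε Bεβ B₁ δ₁ hB₀ hδ₀ hB₁ hδ₁
  obtain ⟨M₀, a₁, a₀', ⟨B, δ⟩, hM₀, ha₁, ha₀', ⟨hB, hδ⟩, H⟩ := h B₀ δ₀ Bβ Bε Bεβ B₁ δ₁ hB₀ hδ₀ hB₁ hδ₁
  refine ⟨max M₀ Mc, min (a₁ / r) αcap, min a₀' ac, ⟨B, δ⟩, lt_max_of_lt_left hM₀, lt_min (div_pos ha₁ hr) hcap, lt_min ha₀' hac, ⟨hB, hδ⟩,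
    fun i hM α₀ hα₀ hMα U hU hT α₁ hα₁ hα₁a U' hU' => ?_⟩
  have hM0 : M₀ ≤ (geo i).M := le_trans (le_max_left _ _) hM
  have hMc : Mc ≤ (geo i).M := le_trans (le_max_right _ _) hM
  have hMa : (geo i).M * α₀ ≤ a₀' := le_trans hMα (min_le_left _ _)
  have hMac : (geo i).M * α₀ ≤ ac := le_trans hMα (min_le_right _ _)
  have hrα : 0 < r * α₁ := mul_pos hr hα₁
  have hrα₁ : r * α₁ ≤ a₁ := by
    have h1 : α₁ ≤ a₁ / r := le_trans hα₁a (min_le_left _ _)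
    calc r * α₁ ≤ r * (a₁ / r) := mul_le_mul_of_nonneg_left h1 hr.le
      _ = a₁ := mul_div_cancel₀ a₁ hr.ne'
  have hαcap : α₁ ≤ αcap := le_trans hα₁a (min_le_right _ _)
  have hTc : Thms31to33IneqAt d (pullK (𝔠 i) (Gp₁ i)) (pullK (𝔠 i) (GA₁ i)) (pullS (𝔠 i) (Cinv i)) B₀ δ₀ Bβ Bε Bεβ B₁ δ₁ (.base U) :=
    (B9SectBCodedCarrier.thms31to33IneqAt_pull_iff (𝔠 i) d (Gp₁ i) (GA₁ i) (Cinv i) B₀ δ₀ Bβ Bε Bεβ B₁ δ₁ (.base U)).2 hT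
  obtain ⟨a, ha, hC⟩ := hclass i α₀ α₁ U U' hMc hα₀ hMac hU hα₁ hαcap hU'
  have key := H i hM0 α₀ hα₀ hMa (.base U) (((𝔠 i).bg_Reg335_base c35 α₀ U).2 hU) hTc (r * α₁) hrα hrα₁ (.mult a)
    (((𝔠 i).bg_Cplx337_base_mult (r * α₁) U a).2 hC)
  intro n lam hh y y' hc hs
  have e : (pullK (𝔠 i) (K i)).l2 n (B9SectBCodedCarrier.CCfg.prod U a) lam hh = (K i).l2 n ((bg i).mul U' U) lam hh := by
    show (K i).l2 n ((𝔠 i).dec (.prod U a)) lam hh = _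
    rw [B9SectBCodedCarrier.Coding.dec_prod, ha]
  rw [← e]
  exact key n lam hh y y' hc hs

end Literature.MathematicalPhysics.QuantumFieldTheory.Balaban1983to89.B9SectBStepL2FamilyTransferPos
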